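import Summits.ResolutionOfSingularities.ResolutionOfSingularities.Theorems.ConeChainCells
import Summits.ResolutionOfSingularities.ResolutionOfSingularities.Theorems.DirectrixCutRoot
import HarnessLib

/-! # ConeChainRoot — decomp-res-lens-4 g42 node «ConeChain», FILE E (§148: the ROOT consumers re-typed to the new located core —
`noForcedTowers_of_g42` = the landed `noForcedTowers_of_g41` (16 binders) with `hcore` re-typed to C₃♮ʳᶠ♯ᵏ♯ᵉᶠ and nothing else changed;
`_residual` twin; `ftt_step_of_g42`; `forcedTowersTerminate_of_g42`).  The only file of the node opening `…Theses` (inside `section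
ConeChainRoot`).  VERBATIM slice of HOME/decomp-res-lens-4/g42/ConeChain.lean. -/


noncomputable section

open CategoryTheory AlgebraicGeometry IsLocalRing TopologicalSpace MvPolynomial
open Literature.AlgebraicGeometry.Resolution
open Summit.ResolutionOfSingularities.ResolutionOfSingularities.Theorems
open WeakOrderReduction ForcedTowerClasses DivergentTowerClasses MonomialTowerClasses
open HugDimensionClasses HugDimensionKernels SurfaceShadowClasses SurfaceShadowKernels
open NearPointCut (SingularClass)
open Scheme.IdealSheafData (vanishingIdeal)

universe u

namespace Summit.ResolutionOfSingularities.ResolutionOfSingularities.Theorems.HugValuationCut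

/-! ## ══ FILE E `Theorems/ConeChainRoot.lean` (§148; imports FILE D and the LANDED `DirectrixCutRoot`; the only file opening `…Theses`) ══ -/

/-! ## §148 (g42 · ROOT) THE ROOT CONSUMERS RE-TYPED TO THE NEW LOCATED CORE — `hcore` ONLY, EVERY OTHER BINDER VERBATIM (g41's
`noForcedTowers_of_g41`, Theorems/DirectrixCutRoot :62) -/

section ConeChainRoot

open Summit.ResolutionOfSingularities.ResolutionOfSingularities.Theses

/-- **the weight-`n` step from the g42 cells**: g41's `ftt_step_of_g41` with the core cell `hK` re-typed to C₃♮ʳᶠ♯ᵏ♯ᵉᶠ (re-location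
`…_iff_g42`) and nothing else changed. [folklore] -/
theorem ftt_step_of_g42 {n : ℕ} (hn : 1 ≤ n) (hMo : MonomialCorner n) (hC : CurveLaw n) (hSL : SurfaceLaw n)
    (hH : HypersurfaceHuggingTowersTerminate n) (hP : ShadowPort n) (hM : MarkingPort n)
    (hRi : RiderPort n) (h71 : ContactHuggingTowersTerminate n) (h640 : SurfaceChainPort)
    (hB : WildLatentFactorNonThreefoldMixedWallFreeFreshJumpShallowCompanionKangarooTowersTerminate n)
    (hK : WildOccultDivisorialThreefoldNonLineRecurrentCompanionCurveFreeBirthRecurrentCofactorBirthRecurrentNarrowCofactorNarrowFlagProperConeMixedWallFreeFreshJumpShallowCompanionKangarooTowersTerminate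
      n)
    (hC4 : WildOccultDivisorialNonThreefoldMixedWallFreeFreshJumpShallowCompanionKangarooTowersTerminate n)
    (hD4 : WildOccultNonDivisorialNonThreefoldMixedWallFreeFreshJumpShallowCompanionKangarooTowersTerminate n)
    (hNP : ContactFreeNonPrincipalInLocusTowersTerminate n) (hPu : PurePrincipalTowersTerminate n)
    (hR : IncommensurableWildDriftingImperfectTowersTerminate n)
    (hlow : ∀ n' : ℕ, 1 ≤ n' → n' < n → ForcedTowersTerminate n') : ForcedTowersTerminate n :=
  ftt_step_of_g41 hn hMo hC hSL hH hP hM hRi h71 h640 hB ((wildOccultDivisorialThreefoldNonLineRecurrentCompanionCurveFreeBirthRecurrentCofactorBirthRecurrentNarrowCofactorNarrowMixed_iff_g42 n hn).mpr hK) hC4 hD4 hNP hPu hR hlow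

/-- **`∀ n ≥ 1, ForcedTowersTerminate n` by strong induction on the weight**, `hcore` re-typed to the g42 core. [folklore] -/
theorem forcedTowersTerminate_of_g42 (hMo : MaxContactCut.MonomialCornerAll) (hC : MaxContactCut.CurveLawAll)
    (hSL : MaxContactCut.SurfaceLawAll) (hH : MaxContactCut.NoHypersurfaceHuggingTowers) (hP : ShadowPortAll)
    (hM : MarkingPortAll) (hRi : RiderPortAll) (h71 : MaxContactCut.NoContactHuggingTowers) (h640 : SurfaceChainPort)
    (hB : NoWildLatentFactorNonThreefoldMixedTowers)
    (hcore : ∀ n : ℕ, 1 ≤ n → MinimalAt n →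
      WildOccultDivisorialThreefoldNonLineRecurrentCompanionCurveFreeBirthRecurrentCofactorBirthRecurrentNarrowCofactorNarrowFlagProperConeMixedWallFreeFreshJumpShallowCompanionKangarooTowersTerminate n)
    (hC4 : NoWildOccultDivisorialNonThreefoldMixedTowers) (hD4 : NoWildOccultNonDivisorialNonThreefoldMixedTowers)
    (hNP : NoContactFreeNonPrincipalInLocusTowers) (hPu : NoPurePrincipalTowers) (hR : NoIncommensurableWildDriftingImperfectTowers) :
    ∀ n : ℕ, 1 ≤ n → ForcedTowersTerminate n :=
  forcedTowersTerminate_of_g41 hMo hC hSL hH hP hM hRi h71 h640 hB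
    (fun n hn hmin => (wildOccultDivisorialThreefoldNonLineRecurrentCompanionCurveFreeBirthRecurrentCofactorBirthRecurrentNarrowCofactorNarrowMixed_iff_g42 n hn).mpr (hcore n hn hmin)) hC4 hD4 hNP hPu hR

/-- **30253 `MaxContactCut.NoForcedTowers` BY NAME from the g42 cells: g41's root consumer with `hcore` re-typed to the FLAGGED DOUBLY
NARROW core C₃♮ʳᶠ♯ᵏ♯ᵉᶠ (minimal currency) and the other 15 binders verbatim.** [folklore] -/
theorem noForcedTowers_of_g42 (hMo : MaxContactCut.MonomialCornerAll) (hC : MaxContactCut.CurveLawAll)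
    (hSL : MaxContactCut.SurfaceLawAll) (hH : MaxContactCut.NoHypersurfaceHuggingTowers) (hP : ShadowPortAll)
    (hM : MarkingPortAll) (hRi : RiderPortAll) (h71 : MaxContactCut.NoContactHuggingTowers) (h640 : SurfaceChainPort)
    (hB : NoWildLatentFactorNonThreefoldMixedTowers)
    (hcore : ∀ n : ℕ, 1 ≤ n → MinimalAt n →
      WildOccultDivisorialThreefoldNonLineRecurrentCompanionCurveFreeBirthRecurrentCofactorBirthRecurrentNarrowCofactorNarrowFlagProperConeMixedWallFreeFreshJumpShallowCompanionKangarooTowersTerminate n)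
    (hC4 : NoWildOccultDivisorialNonThreefoldMixedTowers) (hD4 : NoWildOccultNonDivisorialNonThreefoldMixedTowers)
    (hNP : NoContactFreeNonPrincipalInLocusTowers) (hPu : NoPurePrincipalTowers) (hR : NoIncommensurableWildDriftingImperfectTowers) :
    MaxContactCut.NoForcedTowers :=
  noForcedTowers_of_g41 hMo hC hSL hH hP hM hRi h71 h640 hB
    (fun n hn hmin => (wildOccultDivisorialThreefoldNonLineRecurrentCompanionCurveFreeBirthRecurrentCofactorBirthRecurrentNarrowCofactorNarrowMixed_iff_g42 n hn).mpr (hcore n hn hmin)) hC4 hD4 hNP hPu hR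

/-- the same from the ABSOLUTE g42 located residual by name. [folklore] -/
theorem noForcedTowers_of_g42_residual (hMo : MaxContactCut.MonomialCornerAll) (hC : MaxContactCut.CurveLawAll)
    (hSL : MaxContactCut.SurfaceLawAll) (hH : MaxContactCut.NoHypersurfaceHuggingTowers) (hP : ShadowPortAll)
    (hM : MarkingPortAll) (hRi : RiderPortAll) (h71 : MaxContactCut.NoContactHuggingTowers) (h640 : SurfaceChainPort)
    (hB : NoWildLatentFactorNonThreefoldMixedTowers)
    (hres : NoWildOccultFlaggedDoublyNarrowCofactorBirthRecurrentCurveFreeCompanionNonLineMixedTowers)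
    (hNP : NoContactFreeNonPrincipalInLocusTowers) (hPu : NoPurePrincipalTowers) (hR : NoIncommensurableWildDriftingImperfectTowers) :
    MaxContactCut.NoForcedTowers :=
  noForcedTowers_of_g41_residual hMo hC hSL hH hP hM hRi h71 h640 hB
    (noWildOccultDoublyNarrowCofactorBirthRecurrentCurveFreeCompanionNonLineMixedTowers_of_g42 hres) hNP hPu hR

end ConeChainRoot

end Summit.ResolutionOfSingularities.ResolutionOfSingularities.Theorems.HugValuationCut
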